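import Literature.MathematicalPhysics.QuantumFieldTheory.Balaban1983to89.B4Eq19LatticeHarmonicDecay
import HarnessLib

/-!
# Route `UnitScaleTilt`, crux K1 «MinimiserStabilityRegPr» (stmt-QuantumFields-19200), route-R E′ path (α′) — the sup-row residue (hK), row (N1) «sup ⟹ gradient»:
# THE INTERIOR GRADIENT ESTIMATE FOR LATTICE-HARMONIC FUNCTIONS IN SUP FORM — `|h| ≤ B` on `Q_{(d+2)(ℓ+2)}(x)` ⟹ `|∂_νh(x)| ≤ C_d·B∕ℓ`

Cell `ym3-torus`, D-0154 (3c) twin-width seat `ym-routeR-w2` (gen 5).  THEOREMS ONLY (0 `def`, 0 `sorry`); `--supports stmt-QuantumFields-19200 --as helper`,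
count-neutral.  YM₃ on T³ is a ladder rung (R3), not the Clay problem; nothing here claims the stub, the crux, d = 4 or the gap.

THE POINT (★routeR-w3 g5 18:46:17Z (N) split: «pointwise `|∇G₁| ≲ r⁻²` ⟸ Newtonian `r⁻¹` [Lawler Thm 1.5.4∕1.5.5; Literature-fact route] + ✓ `sq_fdiff_le_of_harmonic`»).
This file packages the second arrow once and for all, by name over lit ✓ `B4Eq19LatticeHarmonicDecay.sq_fdiff_le_of_harmonic` (mixed-Sobolev sup bound of `∂_νh` by the
Dirichlet energy) and ✓ `B4Eq19LatticeCaccioppoli.caccioppoli_harmonic` (energy by the `ℓ²` mass): a `κ`-harmonic (`κ ≥ 0`; `κ = 0` = harmonic) lattice function bounded by `B` on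
the cube `Q_{(d+2)(ℓ+2)}(x)` has `(∂_νh(x))² ≤ K_d·B²∕ℓ²`, `K_d = 2^d(1+56d)^d·14d·(4(d+2))^d`.  Applied to the free lattice Green's function `G₁(·, z)` on cubes not containing
the pole (where it is harmonic) with the Newtonian bound `|G₁| ≤ c_N∕r` on the annulus `r∕2 ≤ |· − z| ≤ 2r`, it gives `|∇G₁| ≤ C·c_N·r⁻²` — the near-field input (N) of the
kernel bound (hK) `Σ_z|K(b,z)| ≲ ℓ` (✓ `…CentreHarmonicInterpKernel.norm_grad_interp_error_le`).

WHAT IS PROVED (ns `…Theorems.Prop7HarmonicSupToGradient`; letters of lit `B4Eq19LatticeOperators`: `Zd d`, `box`, `fdiff`, `lop κ`, `gradSq`).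
* `sum_sq_le_card_mul_of_abs_le` — `Σ_{Q} h² ≤ #Q·B²` under `|h| ≤ B` on `Q`.
* ★★★ `sq_fdiff_le_of_harmonic_of_abs_le` — `κ ≥ 0`, `ℓ ≥ 1`, `lop κ h = 0` and `|h| ≤ B` on `Q_{(d+2)(ℓ+2)}(x)` ⟹ `(∂_νh(x))² ≤ K_d·B²∕ℓ²`.
* ★★ `abs_fdiff_le_of_harmonic_of_abs_le` — the same as `|∂_νh(x)| ≤ √K_d·B∕ℓ`.
HONEST SCOPE.  A corollary of the lit toolkit (Giaquinta Ch. III (2.4)–(2.5) on `ℤ^d`); the Newtonian sup bound itself (N0) is NOT here; constants crude.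

References: M. Giaquinta, *Multiple integrals in the calculus of variations and nonlinear elliptic systems*, Princeton 1983 [Giaquinta1984] (Ch. III §2 (2.4)–(2.5) pp.77–78);
T. Bałaban, CMP 96 (1984) 223–250 [Balaban1984PropagatorsII] ((1.9) p.226); G. F. Lawler, *Intersections of random walks*, Birkhäuser 1991 [Lawler1991] (Thm 1.5.4 p.31).
-/

set_option autoImplicit false

noncomputable section

open scoped BigOperators

namespace Summit.QuantumFields.YangMills.Theorems.Prop7HarmonicSupToGradient

open Literature.MathematicalPhysics.QuantumFieldTheory.Balaban1983to89
open B4Eq19LatticeOperators B4Eq19LatticeCaccioppoli B4Eq19LatticeHarmonicDecay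
open Finset

variable {d : ℕ}

/-- `Σ_{Q} h² ≤ #Q·B²` when `|h| ≤ B` on `Q`. [folklore] -/
theorem sum_sq_le_card_mul_of_abs_le (h : Zd d → ℝ) (Q : Finset (Zd d)) {B : ℝ} (hb : ∀ y ∈ Q, |h y| ≤ B) :
    ∑ y ∈ Q, h y ^ 2 ≤ (Q.card : ℝ) * B ^ 2 := by
  calc ∑ y ∈ Q, h y ^ 2 ≤ ∑ y ∈ Q, B ^ 2 := Finset.sum_le_sum fun y hy => by
          have h1 := hb y hy
          have h0 : 0 ≤ |h y| := abs_nonneg _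
          calc h y ^ 2 = |h y| ^ 2 := (sq_abs _).symm
            _ ≤ B ^ 2 := pow_le_pow_left₀ h0 h1 2
    _ = (Q.card : ℝ) * B ^ 2 := by rw [Finset.sum_const, nsmul_eq_mul]

/-- ★★★ **INTERIOR GRADIENT ESTIMATE IN SUP FORM**: `κ ≥ 0`, `ℓ ≥ 1`; if `lop κ h = 0` and `|h| ≤ B` at every point of the cube `Q_{(d+2)(ℓ+2)}(x)`, then
`(∂_νh(x))² ≤ (2^d(1+56d)^d·14d·(4(d+2))^d)·B²∕ℓ²` (✓ `sq_fdiff_le_of_harmonic` with `ρ₀ = 0` on `Q_{ℓ+d(ℓ+2)}`, then ✓ `caccioppoli_harmonic` with `s = ℓ`, then `Σ h² ≤ #Q·B²`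
and `2((d+2)(ℓ+2)−2)+1 ≤ 4(d+2)(ℓ+1)`). [cite: Giaquinta1984, Ch. III §2 (2.4)–(2.5) pp.77–78] -/
theorem sq_fdiff_le_of_harmonic_of_abs_le {κ : ℝ} (hκ : 0 ≤ κ) (h : Zd d → ℝ) (x : Zd d) {ℓ : ℕ} (hℓ : 1 ≤ ℓ) {B : ℝ}
    (hh : ∀ y ∈ box x ((d + 2 : ℤ) * ((ℓ : ℤ) + 2)), lop κ h y = 0)
    (hb : ∀ y ∈ box x ((d + 2 : ℤ) * ((ℓ : ℤ) + 2)), |h y| ≤ B) (ν : Fin d) :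
    fdiff ν h x ^ 2 ≤ ((2 : ℝ) ^ d * (1 + 56 * d) ^ d * (14 * d) * (4 * ((d : ℝ) + 2)) ^ d) * B ^ 2 / (ℓ : ℝ) ^ 2 := by
  have hℓ0 : (0 : ℝ) < ℓ := by exact_mod_cast hℓ
  have hℓ1 : (1 : ℝ) ≤ ℓ := by exact_mod_cast hℓ
  have hd0 : (0 : ℝ) ≤ d := Nat.cast_nonneg d
  -- radii
  set ρ : ℤ := (ℓ : ℤ) + d * ((ℓ : ℤ) + 2) with hρ
  have hρ0 : 0 ≤ ρ := by rw [hρ]; positivity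
  have hsub1 : box x ((0 : ℤ) + ℓ + d * ((ℓ : ℤ) + 2) + 1) ⊆ box x ((d + 2 : ℤ) * ((ℓ : ℤ) + 2)) :=
    box_mono x (by nlinarith)
  have hsub2 : box x (ρ + ℓ) ⊆ box x ((d + 2 : ℤ) * ((ℓ : ℤ) + 2)) := box_mono x (by rw [hρ]; nlinarith)
  have hsub3 : box x (ρ + ℓ + 2) ⊆ box x ((d + 2 : ℤ) * ((ℓ : ℤ) + 2)) := box_mono x (by rw [hρ]; nlinarith)
  -- step 1: sup of the gradient by the energy
  have h1 := sq_fdiff_le_of_harmonic hκ (z := x) hℓ (le_refl (0 : ℤ)) h (fun y hy => hh y (hsub1 hy)) (self_mem_box x le_rfl) ν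
  have e1 : (0 : ℤ) + ℓ + d * ((ℓ : ℤ) + 2) = ρ := by rw [hρ]; ring
  rw [e1] at h1
  -- step 2: energy by the mass (Caccioppoli, `s = ℓ`)
  have h2 := caccioppoli_harmonic hκ h x hρ0 (by exact_mod_cast hℓ : (1 : ℤ) ≤ ℓ) (fun y hy => hh y (hsub2 hy))
  -- step 3: mass by the sup
  have h3 : ∑ y ∈ box x (ρ + ℓ + 2), h y ^ 2 ≤ ((box x (ρ + ℓ + 2)).card : ℝ) * B ^ 2 :=
    sum_sq_le_card_mul_of_abs_le h _ fun y hy => hb y (hsub3 hy)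
  have hcard : ((box x (ρ + ℓ + 2)).card : ℝ) = ((2 * (ρ + ℓ + 2) + 1 : ℤ) : ℝ) ^ d := card_box x (by linarith)
  -- the side ratio: `2(ρ+ℓ+2)+1 ≤ 4(d+2)ℓ·(ℓ+1)/ℓ`… we use `2(ρ+ℓ+2)+1 ≤ 4(d+2)(ℓ+1)` and `(ℓ+1) ≤ 2ℓ`
  have hside : ((2 * (ρ + ℓ + 2) + 1 : ℤ) : ℝ) ≤ 4 * ((d : ℝ) + 2) * (((ℓ : ℝ) + 1)) := by
    rw [hρ]; push_cast; nlinarith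
  have hside0 : (0 : ℝ) ≤ ((2 * (ρ + ℓ + 2) + 1 : ℤ) : ℝ) := by rw [hρ]; push_cast; positivity
  have hpow : ((2 * (ρ + ℓ + 2) + 1 : ℤ) : ℝ) ^ d ≤ (4 * ((d : ℝ) + 2)) ^ d * ((ℓ : ℝ) + 1) ^ d := by
    rw [← mul_pow]; exact pow_le_pow_left₀ hside0 hside d
  have hB2 : 0 ≤ B ^ 2 := sq_nonneg B
  have hA : 0 ≤ (2 : ℝ) ^ d * (1 + 56 * d) ^ d / ((ℓ : ℝ) + 1) ^ d := by positivity
  have hC : 0 ≤ 14 * (d : ℝ) / (ℓ : ℝ) ^ 2 := by positivity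
  -- combine
  calc fdiff ν h x ^ 2 ≤ (2 : ℝ) ^ d * (1 + 56 * d) ^ d / ((ℓ : ℝ) + 1) ^ d * gradSq h (box x ρ) := h1
    _ ≤ (2 : ℝ) ^ d * (1 + 56 * d) ^ d / ((ℓ : ℝ) + 1) ^ d * ((14 * d / ((ℓ : ℤ) : ℝ) ^ 2) * ∑ y ∈ box x (ρ + ℓ + 2), h y ^ 2) :=
        mul_le_mul_of_nonneg_left h2 hA
    _ ≤ (2 : ℝ) ^ d * (1 + 56 * d) ^ d / ((ℓ : ℝ) + 1) ^ d * ((14 * d / (ℓ : ℝ) ^ 2) * ((4 * ((d : ℝ) + 2)) ^ d * ((ℓ : ℝ) + 1) ^ d * B ^ 2)) := by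
        apply mul_le_mul_of_nonneg_left _ hA
        have : ∑ y ∈ box x (ρ + ℓ + 2), h y ^ 2 ≤ (4 * ((d : ℝ) + 2)) ^ d * ((ℓ : ℝ) + 1) ^ d * B ^ 2 :=
          h3.trans (by rw [hcard]; exact mul_le_mul_of_nonneg_right hpow hB2)
        push_cast
        exact mul_le_mul_of_nonneg_left this hC
    _ = ((2 : ℝ) ^ d * (1 + 56 * d) ^ d * (14 * d) * (4 * ((d : ℝ) + 2)) ^ d) * B ^ 2 / (ℓ : ℝ) ^ 2 := by
        have hl1 : ((ℓ : ℝ) + 1) ^ d ≠ 0 := by positivity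
        field_simp

/-- ★★ the same in absolute-value form: `|∂_νh(x)| ≤ √K_d·B∕ℓ` (`B ≥ 0`). [cite: Giaquinta1984, Ch. III §2 (2.5) p.78] -/
theorem abs_fdiff_le_of_harmonic_of_abs_le {κ : ℝ} (hκ : 0 ≤ κ) (h : Zd d → ℝ) (x : Zd d) {ℓ : ℕ} (hℓ : 1 ≤ ℓ) {B : ℝ} (hB : 0 ≤ B)
    (hh : ∀ y ∈ box x ((d + 2 : ℤ) * ((ℓ : ℤ) + 2)), lop κ h y = 0)
    (hb : ∀ y ∈ box x ((d + 2 : ℤ) * ((ℓ : ℤ) + 2)), |h y| ≤ B) (ν : Fin d) :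
    |fdiff ν h x| ≤ Real.sqrt ((2 : ℝ) ^ d * (1 + 56 * d) ^ d * (14 * d) * (4 * ((d : ℝ) + 2)) ^ d) * B / (ℓ : ℝ) := by
  have hℓ0 : (0 : ℝ) < ℓ := by exact_mod_cast hℓ
  set K : ℝ := (2 : ℝ) ^ d * (1 + 56 * d) ^ d * (14 * d) * (4 * ((d : ℝ) + 2)) ^ d with hK
  have hK0 : 0 ≤ K := by positivity
  have hsq := sq_fdiff_le_of_harmonic_of_abs_le hκ h x hℓ hh hb ν
  have hrhs : K * B ^ 2 / (ℓ : ℝ) ^ 2 = (Real.sqrt K * B / (ℓ : ℝ)) ^ 2 := by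
    rw [div_pow, mul_pow, Real.sq_sqrt hK0]
  rw [hrhs] at hsq
  have hnn : 0 ≤ Real.sqrt K * B / (ℓ : ℝ) := by positivity
  calc |fdiff ν h x| = Real.sqrt (fdiff ν h x ^ 2) := (Real.sqrt_sq_eq_abs _).symm
    _ ≤ Real.sqrt ((Real.sqrt K * B / (ℓ : ℝ)) ^ 2) := Real.sqrt_le_sqrt hsq
    _ = Real.sqrt K * B / (ℓ : ℝ) := Real.sqrt_sq hnn

end Summit.QuantumFields.YangMills.Theorems.Prop7HarmonicSupToGradient

end
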